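import Literature.Probability.Percolation.SlabBlockRenormalisation
import Literature.Probability.Percolation.SlabAnnulusCircuits
import Literature.Probability.Percolation.SlabRSWRectCrossings
import Literature.Probability.Percolation.SlabRSWHalfSide
import Literature.Probability.Percolation.SlabBoxCrossingProperty
import Literature.Probability.Percolation.SlabBoxCrossingPropertyAnnuli
import Mathlib.Algebra.Order.Archimedean.Basic
import HarnessLib

/-!
# Newman–Tassion–Wu 2017, §3.4 and §3.7: the finite-size criterion for `θ > 0` in the slab
# (Lemma 3.11), the upper bound `f(2n, n-1) ≤ 1 - c₁` at `p_c(S_k)` (Lemma 3.13 (i)), and the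
# upper bound (3.60) `sup_n f(n,2n) < 1` at `p_c(S_k)` — modulo the gluing-layer inputs
# (Theorems 3.8, 3.10, Prop. 3.9 (1) and Theorem 3.17 in their high-probability forms)

Topic: `Literature/Probability/Percolation`. Continues the port of §3 of Newman–Tassion–Wu,
*Critical percolation and the minimal spanning tree in slabs* (CPAM 70 (2017); arXiv:1512.09107)
(RSW3 lane, NTW Layer 2b). Printed statements (pp. 14–15, 18 of the arXiv text):

* **Lemma 3.11** (Finite criterion for `θ(p) > 0`). "Fix `k ≥ 0` and `ε > 0` such that
  `ε < p_c(S_k) < 1 - ε`. There exists a constant `c₁ > 0`, such that … for every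
  `p ∈ [ε, 1 - ε]` and every `n ≥ 4r`, `f_p(2n, n-1) > 1 - c₁ ⟹ P_p[0 ⟷^{S_k} ∞] > 0`."
* **Lemma 3.13** (first half). "For critical Bernoulli percolation on `S_k` … we have
  `f_p(2n, n-1) ≤ 1 - c₁` … for every `n ≥ 4r`."
* **(3.60)** (§3.7). "By Lemma 3.13, Item 2 of Proposition 3.9 and Theorem 3.17, we have
  `sup_{n≥1} f(n,2n) < 1`."

The proof of Lemma 3.11 (pp. 14–15) runs: the CLAIM (a `1`-dependent renormalisation on
`G = 3nℤ²` whose coarse edge `{u,v}` is open iff the minimal open circuits of `Ā_{m,n}(u)` and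
`Ā_{m,n}(v)` exist and are joined by an open path inside `u + [0,3n] × [-m,m]`; the tree's
`NTW17.exists_eta_blockCore`, here instantiated with `NTW17.minCircuit` as the core —
`circuitBlockCore`), whose edge probability is bounded below by THEOREM 3.8 (gluing of minimal
circuits, `≥ h₁(f(3n,2m) a(m,n)²)`); then (3.75) THEOREM 3.10 (`f(2n,n-1) ≥ 1/4 ⟹
P[𝒜_{λn,2λn}] ≥ c'`), (3.76) PROP. 3.9 (1) (`f(2m,m-1) > 1 - c₁ ⟹ f(2^ℓλm, m-1) ≥ 1 - η`), and
(3.77) independence of disjoint annuli (`P[𝒜_{m,2^ℓλm}] ≥ 1 - (1-c')^ℓ`).  The three displayed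
inputs belong to the GLUING LAYER of the port (local surgery in the high-probability regime) and
are taken here as HYPOTHESES IN FINAL FORM, uniformly in `p ∈ [ε, 1-ε]` and in the centre of the
annulus (NTW state them at the origin; translation invariance of `P_p` is immediate):

* `(H38)`  ∀ η > 0 ∃ δ > 0 ∀ p ∈ [ε,1-ε] ∀ m₀ ≤ m ≤ n ∀ z ∀ i:  `f_p(3n,2m) ≥ 1-δ`,
  `P_p(𝒜_{m,n}(z)) ≥ 1-δ`, `P_p(𝒜_{m,n}(z + 3n eᵢ)) ≥ 1-δ` ⟹ `P_p[Γ_min(z) ⟷^{R_i(z)} Γ_min(z+3neᵢ)] ≥ 1-η`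
  (Theorem 3.8 in `ε-δ` form, `R₀(z) = z + [0,3n]×[-m,m]`, `R₁(z) = z + [-m,m]×[0,3n]`);
* `(H310)` ∀ c > 0 ∃ λ ≥ 1, c' > 0 ∀ p ∈ [ε,1-ε] ∀ n ≥ m₀ ∀ z: `f_p(2n,n-1) ≥ c ⟹ P_p(𝒜_{λn,2λn}(z)) ≥ c'`
  (Theorem 3.10);
* `(H39)`  ∀ η > 0 ∀ j ≥ 1 ∃ δ > 0 ∀ p ∈ [ε,1-ε] ∀ m ≥ m₀: `f_p(2m,m-1) ≥ 1-δ ⟹ f_p(jm, m-1) ≥ 1-η`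
  (Prop. 3.9 (1), high-probability regime, as used in (3.76));
* `(H317)` at `p = p_c(S_k)`: `sup_n f(n,2n) = 1 ⟹ sup_{n ≥ m₀} f(2n,n-1) = 1` (Theorem 3.17 with the
  Prop. 3.9 step of §3.7).

PROVED here: `NTW17.circuitBlockCore` (the block structure of the Claim), the independence of
disjoint annuli `real_circuitAround_amplify` ((3.77)), **`NTW17.lemma311_of`** (Lemma 3.11 from
(H38), (H310), (H39)), **`NTW17.lemma313_i_of`** (Lemma 3.13 (i): at `p_c(S_k)`,
`f(2n,n-1) ≤ 1 - c₁` for `n ≥ m₀`, by continuity in `p` and the definition of `p_c`), and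
**`NTW17.h360_of`** ((3.60) at `p_c(S_k)`: `∃ c₂ > 0 ∀ n ≥ 1, f(n,2n) ≤ 1 - c₂`, from Lemma
3.13 (i) and (H317)) — the input `(H360)` of the tree's `Crossing.NewmanTassionWu2017_thm31_of`.

## Sources

* C. M. Newman, V. Tassion, W. Wu, *Critical percolation and the minimal spanning tree in
  slabs*, Comm. Pure Appl. Math. 70 (2017) 2084–2120, arXiv:1512.09107: §3.4 Lemma 3.11 with
  its proof ((3.74)–(3.77)), Lemma 3.13, Theorems 3.8, 3.10, Prop. 3.9, Theorem 3.17, §3.7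
  ((3.59)–(3.60)); pp. 11–15 and 17–18 of the arXiv text [NewmanTassionWu2017].

## Design choices

* The hypotheses are propositions over tree declarations only (`NTW17.crossingProb`,
  `NTW17.circuitAround`, `NTW17.minCircuit`, `slabConn`, `openConnIn`); no new `Prop` definitions.
* `f(2n, n-1)` is `crossingProb k p (2n) (n-1)` with natural subtraction (`n ≥ m₀ ≥ 1` throughout).
* Lemma 3.11 is proved with `≥ 1 - c₁` in place of the printed `> 1 - c₁` (stronger).
-/

noncomputable section

namespace Literature.Probability.Percolation

open MeasureTheory LatticeModels SimpleGraph

namespace NTW17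

variable (k : ℕ)

/-! ## Independence of disjoint annuli ((3.77)) -/

/-- `𝒜_{m,n}(c)` is determined by the edges inside the ANNULUS `Ā_{m,n}(c)` (a surrounding
circuit lives there). [cite: NewmanTassionWu2017, §3.4 (proof of Lemma 3.11, "by independence", (3.77))] -/
theorem determinedBy_circuitAround_annulus (c : ℤ × ℤ) (m n : ℕ) :
    DeterminedBy (circuitAround k c m n) (Set.sym2 (slabLift k (annulus c m n))) := by
  rw [determinedBy_iff]
  intro ω ω' h
  have key : ∀ {ω ω' : BondConfig (slab 3 k)},
      ω ∩ Set.sym2 (slabLift k (annulus c m n)) = ω' ∩ Set.sym2 (slabLift k (annulus c m n)) →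
      ∀ l, IsOpenCircuit k ω (slabLift k (annulus c m n)) l → IsOpenCircuit k ω' (slabLift k (annulus c m n)) l := by
    intro ω ω' h l hl
    refine hl.of_edges fun a ha b hb hab => ?_
    have hmem : s(a, b) ∈ Set.sym2 (slabLift k (annulus c m n)) :=
      Set.mk_mem_sym2_iff.2 ⟨hl.subset a ha, hl.subset b hb⟩
    exact ((Set.ext_iff.1 h s(a, b)).1 ⟨hab, hmem⟩).1
  constructor
  · rintro ⟨l, hl, hs⟩; exact ⟨l, key h l hl, hs⟩
  · rintro ⟨l, hl, hs⟩; exact ⟨l, key h.symm l hl, hs⟩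

/-- The complement of an event determined by `K` is determined by `K`. [folklore] -/
private theorem determinedBy_compl' {ι : Type*} {A : Set (Set ι)} {K : Set ι} (hA : DeterminedBy A K) :
    DeterminedBy Aᶜ K := by
  rw [determinedBy_iff] at hA ⊢
  intro ω ω' h
  rw [Set.mem_compl_iff, Set.mem_compl_iff, hA ω ω' h]

/-- **Product formula for finitely many events determined by pairwise disjoint edge sets**
(Bernoulli percolation on any countable graph). [cite: NewmanTassionWu2017, §3.4 (proof of Lemma 3.11, "by independence", (3.77))] -/
theorem real_biInter_eq_prod {V : Type*} [Countable V] (G : SimpleGraph V) (p : unitInterval)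
    (E : ℕ → Set (BondConfig V)) (T : ℕ → Set (Sym2 V)) (hdet : ∀ i, DeterminedBy (E i) (T i))
    (hmeas : ∀ i, MeasurableSet (E i)) (hdisj : ∀ i j, i ≠ j → Disjoint (T i) (T j)) (ℓ : ℕ) :
    (bondPercolation G p).real (⋂ i ∈ Finset.range ℓ, E i) =
      ∏ i ∈ Finset.range ℓ, (bondPercolation G p).real (E i) := by
  induction ℓ with
  | zero => simp
  | succ ℓ ih =>
    rw [Finset.prod_range_succ, ← ih]
    have hset : (⋂ i ∈ Finset.range (ℓ + 1), E i) = (⋂ i ∈ Finset.range ℓ, E i) ∩ E ℓ := by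
      ext ω
      simp only [Set.mem_iInter, Finset.mem_range, Set.mem_inter_iff]
      constructor
      · intro h; exact ⟨fun i hi => h i (Nat.lt_succ_of_lt hi), h ℓ (Nat.lt_succ_self ℓ)⟩
      · rintro ⟨h1, h2⟩ i hi
        rcases Nat.lt_succ_iff_lt_or_eq.1 hi with hi | rfl
        · exact h1 i hi
        · exact h2
    rw [hset]
    have hdetI : DeterminedBy (⋂ i ∈ Finset.range ℓ, E i) (⋃ i ∈ Finset.range ℓ, T i) := by
      clear ih hset
      induction ℓ with
      | zero => simp only [Finset.range_zero, Finset.notMem_empty, Set.iInter_of_empty,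
          Set.iInter_univ]; exact determinedBy_univ _
      | succ ℓ ih' =>
        have hset' : (⋂ i ∈ Finset.range (ℓ + 1), E i) = (⋂ i ∈ Finset.range ℓ, E i) ∩ E ℓ := by
          ext ω
          simp only [Set.mem_iInter, Finset.mem_range, Set.mem_inter_iff]
          constructor
          · intro h; exact ⟨fun i hi => h i (Nat.lt_succ_of_lt hi), h ℓ (Nat.lt_succ_self ℓ)⟩
          · rintro ⟨h1, h2⟩ i hi
            rcases Nat.lt_succ_iff_lt_or_eq.1 hi with hi | rfl
            · exact h1 i hi
            · exact h2
        rw [hset']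
        refine (ih'.mono ?_).inter ((hdet ℓ).mono ?_)
        · exact Set.biUnion_subset_biUnion_left fun i hi => by
            simp only [Finset.coe_range, Set.mem_Iio] at hi ⊢; omega
        · exact Set.subset_biUnion_of_mem (by simp)
    have hmeasI : MeasurableSet (⋂ i ∈ Finset.range ℓ, E i) :=
      MeasurableSet.biInter (Finset.range ℓ).countable_toSet fun i _ => hmeas i
    have hdisjI : Disjoint (⋃ i ∈ Finset.range ℓ, T i) (T ℓ) := by
      rw [Set.disjoint_iUnion₂_left]
      intro i hi
      exact hdisj i ℓ (by simp at hi; omega)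
    exact bondPercolation_real_inter_of_disjoint G p hdisjI hdetI (hdet ℓ) hmeasI (hmeas ℓ)

variable {k}

/-- Nested dyadic annuli `A_{s, 2s}(z)` and `A_{s', 2s'}(z)` with `2s ≤ s'` are disjoint. [cite: NewmanTassionWu2017, §3.4 (proof of Lemma 3.11, (3.77))] -/
theorem disjoint_annulus_of_le (z : ℤ × ℤ) {s s' : ℕ} (h : 2 * s ≤ s') :
    Disjoint (annulus z s (2 * s)) (annulus z s' (2 * s')) := by
  rw [Set.disjoint_left]
  intro w hw hw'
  rw [mem_annulus_iff] at hw hw'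
  push_cast at hw hw'
  omega

/-- **(3.77): independent trials in disjoint annuli.** If each of the `ℓ` annuli
`A_{λ2^i m, 2λ2^i m}(z)`, `i < ℓ`, contains an open circuit surrounding `z` with probability `≥ c'`,
then `P_p(𝒜_{m, λ2^ℓ m}(z)) ≥ 1 - (1 - c')^ℓ` (`λ ≥ 1`).
[cite: NewmanTassionWu2017, §3.4 (proof of Lemma 3.11, eq. (3.77))] -/
theorem real_circuitAround_amplify (p : unitInterval) (z : ℤ × ℤ) {m lam ℓ : ℕ} (hlam : 1 ≤ lam)
    {c' : ℝ}
    (h : ∀ i, i < ℓ → c' ≤ (bondPercolation (slabGraph 3 k) p).real (circuitAround k z (lam * 2 ^ i * m) (2 * (lam * 2 ^ i * m)))) :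
    1 - (1 - c') ^ ℓ ≤ (bondPercolation (slabGraph 3 k) p).real (circuitAround k z m (lam * 2 ^ ℓ * m)) := by
  set P := bondPercolation (slabGraph 3 k) p with hP
  set E : ℕ → Set (BondConfig (slab 3 k)) := fun i => (circuitAround k z (lam * 2 ^ i * m) (2 * (lam * 2 ^ i * m)))ᶜ with hE
  set T : ℕ → Set (Sym2 (slab 3 k)) := fun i => Set.sym2 (slabLift k (annulus z (lam * 2 ^ i * m) (2 * (lam * 2 ^ i * m)))) with hT
  have hdet : ∀ i, DeterminedBy (E i) (T i) := fun i => determinedBy_compl' (determinedBy_circuitAround_annulus k z _ _)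
  have hmeas : ∀ i, MeasurableSet (E i) := fun i => (measurableSet_circuitAround z _ _).compl
  have hdisj : ∀ i j, i ≠ j → Disjoint (T i) (T j) := by
    intro i j hij
    rcases Nat.lt_or_gt_of_ne hij with hlt | hlt
    · refine disjoint_sym2_slabLift (disjoint_annulus_of_le z ?_)
      calc 2 * (lam * 2 ^ i * m) = lam * 2 ^ (i + 1) * m := by ring
        _ ≤ lam * 2 ^ j * m := by
          apply Nat.mul_le_mul_right; apply Nat.mul_le_mul_left
          exact Nat.pow_le_pow_right (by norm_num) hlt
    · refine (disjoint_sym2_slabLift (disjoint_annulus_of_le z ?_)).symm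
      calc 2 * (lam * 2 ^ j * m) = lam * 2 ^ (j + 1) * m := by ring
        _ ≤ lam * 2 ^ i * m := by
          apply Nat.mul_le_mul_right; apply Nat.mul_le_mul_left
          exact Nat.pow_le_pow_right (by norm_num) hlt
  have hprod := real_biInter_eq_prod (slabGraph 3 k) p E T hdet hmeas hdisj ℓ
  -- the union of the small events is contained in the big one
  have hsub : (⋂ i ∈ Finset.range ℓ, E i)ᶜ ⊆ circuitAround k z m (lam * 2 ^ ℓ * m) := by
    intro ω hω
    simp only [Set.mem_compl_iff, Set.mem_iInter, Finset.mem_range, not_forall] at hω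
    obtain ⟨i, hi, hωi⟩ := hω
    simp only [hE, Set.mem_compl_iff, not_not] at hωi
    refine circuitAround_mono ?_ ?_ hωi
    · calc m = 1 * 1 * m := by ring
        _ ≤ lam * 2 ^ i * m := by
          apply Nat.mul_le_mul_right
          exact Nat.mul_le_mul hlam (Nat.one_le_two_pow)
    · calc 2 * (lam * 2 ^ i * m) = lam * 2 ^ (i + 1) * m := by ring
        _ ≤ lam * 2 ^ ℓ * m := by
          apply Nat.mul_le_mul_right; apply Nat.mul_le_mul_left
          exact Nat.pow_le_pow_right (by norm_num) hi
  have hbound : P.real (⋂ i ∈ Finset.range ℓ, E i) ≤ (1 - c') ^ ℓ := by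
    rw [hprod]
    calc ∏ i ∈ Finset.range ℓ, (bondPercolation (slabGraph 3 k) p).real (E i)
        ≤ ∏ _i ∈ Finset.range ℓ, (1 - c') := by
          refine Finset.prod_le_prod (fun i _ => measureReal_nonneg) fun i hi => ?_
          rw [Finset.mem_range] at hi
          have hc := h i hi
          have : P.real (E i) = 1 - P.real (circuitAround k z (lam * 2 ^ i * m) (2 * (lam * 2 ^ i * m))) := by
            rw [hE]
            exact probReal_compl_eq_one_sub (measurableSet_circuitAround z _ _)
          rw [← hP, this]
          linarith
      _ = (1 - c') ^ ℓ := by rw [Finset.prod_const, Finset.card_range]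
  have hcompl : P.real (⋂ i ∈ Finset.range ℓ, E i)ᶜ = 1 - P.real (⋂ i ∈ Finset.range ℓ, E i) :=
    probReal_compl_eq_one_sub (MeasurableSet.biInter (Finset.range ℓ).countable_toSet fun i _ => hmeas i)
  have := measureReal_mono hsub (μ := P) (measure_ne_top _ _)
  rw [hcompl] at this
  linarith

/-! ## Crossing probabilities: monotonicity and continuity -/

/-- `f_p(a, b)` is non-increasing in the width `a` and non-decreasing in the height `b`.
[cite: NewmanTassionWu2017, §3.4 (proof of Lemma 3.11, "(3.76) and (3.75) give for every 0 ≤ i ≤ ℓ-1")] -/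
theorem crossingProb_mono (p : unitInterval) {a a' b b' : ℕ} (ha : a' ≤ a) (hb : b ≤ b') :
    crossingProb k p a b ≤ crossingProb k p a' b' := by
  rw [crossingProb_eq, crossingProb_eq]
  calc (bondPercolation (slabGraph 3 k) p).real (slabConn k (boxR 0 a 0 b) {z | z.1 = 0} {z | z.1 = (a : ℤ)})
      ≤ (bondPercolation (slabGraph 3 k) p).real (slabConn k (boxR 0 a' 0 b) {z | z.1 = 0} {z | z.1 = (a' : ℤ)}) :=
        real_lr_wider_le (by positivity) (by exact_mod_cast ha) p
    _ ≤ (bondPercolation (slabGraph 3 k) p).real (slabConn k (boxR 0 a' 0 b') {z | z.1 = 0} {z | z.1 = (a' : ℤ)}) :=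
        real_lr_le_taller le_rfl (by exact_mod_cast hb) p

/-- `p ↦ f_p(a, b)` is continuous (a polynomial in `p`). [cite: NewmanTassionWu2017, §3.4 (proof of Lemma 3.13, "It is open")] -/
theorem continuous_crossingProb (a b : ℕ) : Continuous fun p : unitInterval => crossingProb k p a b :=
  continuous_bondPercolation_real_of_isLocalEvent (slabGraph 3 k) (isLocalEvent_slabConn_boxR _ _ _ _ _ _)

variable (k)

/-! ## The block structure of the Claim: minimal circuits of `Ā_{m,n}` at spacing `3n` -/

/-- **The window of a coarse edge**: `R₀(z) = z + [0,3n] × [-m,m]` (direction `e₀`) and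
`R₁(z) = z + [-m,m] × [0,3n]` (direction `e₁`) — NTW's `u + ([0,3n] × [-m,m])`.
[cite: NewmanTassionWu2017, §3.4 (proof of Lemma 3.11, definition of X(e))] -/
def linkRect (z : ℤ × ℤ) (m n : ℕ) (i : Fin 2) : Set (ℤ × ℤ) :=
  if i = 0 then boxR z.1 (z.1 + 3 * n) (z.2 - m) (z.2 + m) else boxR (z.1 - m) (z.1 + m) z.2 (z.2 + 3 * n)

/-- **NTW's edge event `{X(e) = 1}`** for the coarse edge from `z` in direction `i`: the minimal open
circuits of `Ā_{m,n}(z)` and of `Ā_{m,n}(z + 3n eᵢ)` both exist and are joined by an open path inside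
the window `R_i(z)`. [cite: NewmanTassionWu2017, §3.4 (proof of Lemma 3.11, definition of X(e))] -/
def linkEvent (z : ℤ × ℤ) (m n : ℕ) (i : Fin 2) : Set (BondConfig (slab 3 k)) :=
  {ω | ∃ a ∈ minCircuit k ω z m n, ∃ b ∈ minCircuit k ω (z + coarseShift (3 * n) i) m n,
    ω ∈ openConnIn (slabLift k (linkRect z m n i)) a b}

/-- **The block structure of the Claim**: spacing `N = 3n`, core radius `n`, and the core at `z`
= the vertex set of the minimal open circuit of `Ā_{m,n}(z)` surrounding `z` (determined by the
edges inside `\overline{B_n(z)}`, and connected). [cite: NewmanTassionWu2017, §3.4 (proof of Lemma 3.11, the process X)] -/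
def circuitBlockCore (m n : ℕ) (hn : 1 ≤ n) : BlockCore k where
  N := 3 * n
  M := n
  one_le_N := by omega
  M_le_N := by omega
  core := fun z ω => {v | v ∈ minCircuit k ω z m n}
  core_subset := fun z ω v hv => minCircuit_subset ω z m n v hv
  core_local := fun z ω ω' h => by
    ext v
    simp only [Set.mem_setOf_eq, minCircuit_local h]
  core_conn := fun _ _ _ ha _ hb => reachable_of_mem_minCircuit ha hb

variable {k}

/-- The window `R_i(z)` lies in the box `z + B_{6n}` of the block structure (`m ≤ n`).
[cite: NewmanTassionWu2017, §3.4 (proof of Lemma 3.11)] -/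
theorem linkRect_subset_sqBox (z : ℤ × ℤ) {m n : ℕ} (hmn : m ≤ n) (i : Fin 2) :
    linkRect z m n i ⊆ sqBox z (2 * (3 * n)) := by
  intro w hw
  simp only [linkRect] at hw
  simp only [sqBox, Set.mem_setOf_eq, abs_le]
  fin_cases i <;> simp [mem_boxR_iff] at hw <;> push_cast <;> omega

/-- **`{X(e) = 1} ⊆` the link event of the block structure** (same cores; the window `R_i(z)` lies
in `z + B_{6n}`). [cite: NewmanTassionWu2017, §3.4 (proof of Lemma 3.11)] -/
theorem linkEvent_subset_link (z : ℤ × ℤ) {m n : ℕ} (hn : 1 ≤ n) (hmn : m ≤ n) (i : Fin 2) :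
    linkEvent k z m n i ⊆ (circuitBlockCore k m n hn).link z i := by
  rintro ω ⟨a, ha, b, hb, hab⟩
  exact ⟨a, ha, b, hb, openConnIn_mono (slabLift_mono k (linkRect_subset_sqBox z hmn i)) a b hab⟩

/-! ## Lemma 3.11 -/

/-- **NTW 2017, Lemma 3.11 (finite criterion for `θ(p) > 0`), from the gluing-layer inputs.**
Fix `k`, `ε > 0` and `m₀ ≥ 1`.  Assume (H38) the `ε-δ` form of Theorem 3.8 (gluing of the minimal
circuits of two annuli at distance `3n` inside the window `R_i(z)`), (H310) Theorem 3.10 (open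
circuits in `A_{λn,2λn}` from `f(2n,n-1) ≥ c`) and (H39) Prop. 3.9 (1) in the high-probability
regime, all uniformly in `p ∈ [ε, 1-ε]` and in the centre.  Then there is `c₁ > 0` such that for
every `p ∈ [ε, 1-ε]` and `m ≥ m₀`: `f_p(2m, m-1) ≥ 1 - c₁ ⟹ θ_{S_k}(p) > 0`.
Proof = NTW's: (3.76) one application of (H39) with `j = 3·2^ℓ·λ` makes all needed long crossings
`≥ 1 - η`; (3.75) + (3.77) (`real_circuitAround_amplify`) make `P(𝒜_{m, λ2^ℓ m}(z)) ≥ 1 - (1-c')^ℓ`;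
(H38) then bounds the edge events of the block structure `circuitBlockCore` below by `1 - η₀/2`, and
the Claim (`exists_eta_blockCore`) gives `θ > 0`.
[cite: NewmanTassionWu2017, Lemma 3.11 (and its proof, (3.74)–(3.77))] -/
theorem lemma311_of {ε : ℝ} (hε : 0 < ε) {m₀ : ℕ} (hm₀ : 1 ≤ m₀)
    (h38 : ∀ η : ℝ, 0 < η → ∃ δ : ℝ, 0 < δ ∧ ∀ p : unitInterval, ε ≤ (p : ℝ) → (p : ℝ) ≤ 1 - ε →
      ∀ m n : ℕ, m₀ ≤ m → m ≤ n → ∀ (z : ℤ × ℤ) (i : Fin 2),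
      1 - δ ≤ crossingProb k p (3 * n) (2 * m) →
      1 - δ ≤ (bondPercolation (slabGraph 3 k) p).real (circuitAround k z m n) →
      1 - δ ≤ (bondPercolation (slabGraph 3 k) p).real (circuitAround k (z + coarseShift (3 * n) i) m n) →
      1 - η ≤ (bondPercolation (slabGraph 3 k) p).real (linkEvent k z m n i))
    (h310 : ∀ c : ℝ, 0 < c → ∃ lam : ℕ, 1 ≤ lam ∧ ∃ c' : ℝ, 0 < c' ∧ ∀ p : unitInterval,
      ε ≤ (p : ℝ) → (p : ℝ) ≤ 1 - ε → ∀ n : ℕ, m₀ ≤ n → c ≤ crossingProb k p (2 * n) (n - 1) →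
      ∀ z : ℤ × ℤ, c' ≤ (bondPercolation (slabGraph 3 k) p).real (circuitAround k z (lam * n) (2 * (lam * n))))
    (h39 : ∀ η : ℝ, 0 < η → ∀ j : ℕ, 1 ≤ j → ∃ δ : ℝ, 0 < δ ∧ ∀ p : unitInterval,
      ε ≤ (p : ℝ) → (p : ℝ) ≤ 1 - ε → ∀ m : ℕ, m₀ ≤ m →
      1 - δ ≤ crossingProb k p (2 * m) (m - 1) → 1 - η ≤ crossingProb k p (j * m) (m - 1)) :
    ∃ c₁ : ℝ, 0 < c₁ ∧ ∀ p : unitInterval, ε ≤ (p : ℝ) → (p : ℝ) ≤ 1 - ε →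
      ∀ m : ℕ, m₀ ≤ m → 1 - c₁ ≤ crossingProb k p (2 * m) (m - 1) →
        0 < theta (slabGraph 3 k) (slabOrigin 3 k) p := by
  -- the universal `η₀` of the Claim, then `δ₁` from (H38)
  obtain ⟨η₀, hη₀, hClaim⟩ := exists_eta_blockCore
  obtain ⟨δ₁, hδ₁, h38'⟩ := h38 (η₀ / 2) (by linarith)
  -- (3.75): `λ`, `c'` from (H310) with `c = 1/4`
  obtain ⟨lam, hlam, c', hc', h310'⟩ := h310 (1 / 4) (by norm_num)
  set c'' : ℝ := min c' (1 / 2) with hc''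
  have hc''pos : 0 < c'' := lt_min hc' (by norm_num)
  have hc''le : c'' ≤ c' := min_le_left _ _
  -- `ℓ` with `(1 - c'')^ℓ < δ₁`
  obtain ⟨ℓ, hℓ⟩ := exists_pow_lt_of_lt_one hδ₁ (show 1 - c'' < 1 by linarith)
  -- (3.76): `δ₂ = c₁` from (H39) with `η₂ = min δ₁ (3/4)` and `j = 3 · 2^ℓ · λ`
  set η₂ : ℝ := min δ₁ (3 / 4) with hη₂
  have hη₂pos : 0 < η₂ := lt_min hδ₁ (by norm_num)
  have hj : 1 ≤ 3 * 2 ^ ℓ * lam := by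
    have := Nat.one_le_two_pow (n := ℓ)
    calc 1 = 1 * 1 * 1 := by ring
      _ ≤ 3 * 2 ^ ℓ * lam := Nat.mul_le_mul (Nat.mul_le_mul (by norm_num) this) hlam
  obtain ⟨δ₂, hδ₂, h39'⟩ := h39 η₂ hη₂pos (3 * 2 ^ ℓ * lam) hj
  refine ⟨δ₂, hδ₂, fun p hpε hp1 m hm hF0 => ?_⟩
  have hp0 : 0 < (p : ℝ) := lt_of_lt_of_le hε hpε
  -- all the long crossings at once
  have hF : 1 - η₂ ≤ crossingProb k p (3 * 2 ^ ℓ * lam * m) (m - 1) := h39' p hpε hp1 m hm hF0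
  have hF₁ : 1 - δ₁ ≤ crossingProb k p (3 * 2 ^ ℓ * lam * m) (m - 1) := (by
    have : η₂ ≤ δ₁ := min_le_left _ _; linarith)
  have hF₂ : (1 : ℝ) / 4 ≤ crossingProb k p (3 * 2 ^ ℓ * lam * m) (m - 1) := (by
    have : η₂ ≤ 3 / 4 := min_le_right _ _; linarith)
  -- the scales
  set n : ℕ := lam * 2 ^ ℓ * m with hn
  have hm1 : 1 ≤ m := hm₀.trans hm
  have hmn : m ≤ n := by
    rw [hn]
    calc m = 1 * 1 * m := by ring
      _ ≤ lam * 2 ^ ℓ * m := Nat.mul_le_mul_right _ (Nat.mul_le_mul hlam Nat.one_le_two_pow)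
  have hn1 : 1 ≤ n := hm1.trans hmn
  -- (3.75) + (3.77): circuits in `A_{m,n}(w)` with probability `≥ 1 - δ₁`, for every centre `w`
  have hA : ∀ w : ℤ × ℤ, 1 - δ₁ ≤ (bondPercolation (slabGraph 3 k) p).real (circuitAround k w m n) := by
    intro w
    have hamp := real_circuitAround_amplify (k := k) p w (m := m) (lam := lam) (ℓ := ℓ) hlam (c' := c'')
      (fun i hi => ?_)
    · rw [hn]
      have : (1 - c'') ^ ℓ < δ₁ := hℓ
      linarith
    -- (H310) at scale `2^i m`
    have hscale : m₀ ≤ 2 ^ i * m := hm.trans (by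
      calc m = 1 * m := (one_mul m).symm
        _ ≤ 2 ^ i * m := Nat.mul_le_mul_right _ Nat.one_le_two_pow)
    have hcross : (1 : ℝ) / 4 ≤ crossingProb k p (2 * (2 ^ i * m)) (2 ^ i * m - 1) := by
      refine hF₂.trans (crossingProb_mono p ?_ ?_)
      · calc 2 * (2 ^ i * m) = 2 ^ (i + 1) * 1 * m := by ring
          _ ≤ 2 ^ ℓ * lam * m := Nat.mul_le_mul_right _
              (Nat.mul_le_mul (Nat.pow_le_pow_right (by norm_num) hi) hlam)
          _ = 2 ^ ℓ * lam * m := rfl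
          _ ≤ 3 * 2 ^ ℓ * lam * m := by
              rw [mul_assoc 3, mul_assoc 3]; exact Nat.le_mul_of_pos_left _ (by norm_num)
      · have : m ≤ 2 ^ i * m := by
          calc m = 1 * m := (one_mul m).symm
            _ ≤ 2 ^ i * m := Nat.mul_le_mul_right _ Nat.one_le_two_pow
        omega
    have h := h310' p hpε hp1 (2 ^ i * m) hscale hcross w
    have e1 : lam * (2 ^ i * m) = lam * 2 ^ i * m := by ring
    rw [e1] at h
    exact hc''le.trans h
  -- `f(3n, 2m) ≥ 1 - δ₁`
  have hlong : 1 - δ₁ ≤ crossingProb k p (3 * n) (2 * m) := by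
    refine hF₁.trans (crossingProb_mono p (le_of_eq ?_) (by omega))
    rw [hn]; ring
  -- the Claim for the block structure of minimal circuits
  refine hClaim k (circuitBlockCore k m n hn1) p hp0 fun x i => ?_
  have hz := h38' p hpε hp1 m n hm hmn (blockPt (3 * n) x) i hlong (hA _) (hA _)
  have hsub := measureReal_mono (linkEvent_subset_link (k := k) (blockPt (3 * n) x) hn1 hmn i)
    (μ := bondPercolation (slabGraph 3 k) p) (measure_ne_top _ _)
  have : (circuitBlockCore k m n hn1).N = 3 * n := rfl
  rw [this]
  linarith

/-! ## Lemma 3.13 (i) -/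

/-- **NTW 2017, Lemma 3.13, first half: `f_{p_c(S_k)}(2n, n-1) ≤ 1 - c₁` for every `n ≥ m₀`.**
With `ε < p_c(S_k) ≤ 1 - ε` and the inputs of Lemma 3.11 on `[ε, 1-ε]`: the set of `p` with
`f_p(2n,n-1) > 1 - c₁` for some `n ≥ m₀` "is open and does not intersect `[0, p_c(S_k))` (by Lemma
3.11). Thus, `p_c` does not belong to this set".
[cite: NewmanTassionWu2017, Lemma 3.13 (first inequality) and its proof] -/
theorem lemma313_i_of {ε : ℝ} (hε : 0 < ε) {m₀ : ℕ} (hm₀ : 1 ≤ m₀)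
    (hεc : ε < criticalProb (slabGraph 3 k) (slabOrigin 3 k))
    (hc1 : criticalProb (slabGraph 3 k) (slabOrigin 3 k) ≤ 1 - ε)
    (h38 : ∀ η : ℝ, 0 < η → ∃ δ : ℝ, 0 < δ ∧ ∀ p : unitInterval, ε ≤ (p : ℝ) → (p : ℝ) ≤ 1 - ε →
      ∀ m n : ℕ, m₀ ≤ m → m ≤ n → ∀ (z : ℤ × ℤ) (i : Fin 2),
      1 - δ ≤ crossingProb k p (3 * n) (2 * m) →
      1 - δ ≤ (bondPercolation (slabGraph 3 k) p).real (circuitAround k z m n) →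
      1 - δ ≤ (bondPercolation (slabGraph 3 k) p).real (circuitAround k (z + coarseShift (3 * n) i) m n) →
      1 - η ≤ (bondPercolation (slabGraph 3 k) p).real (linkEvent k z m n i))
    (h310 : ∀ c : ℝ, 0 < c → ∃ lam : ℕ, 1 ≤ lam ∧ ∃ c' : ℝ, 0 < c' ∧ ∀ p : unitInterval,
      ε ≤ (p : ℝ) → (p : ℝ) ≤ 1 - ε → ∀ n : ℕ, m₀ ≤ n → c ≤ crossingProb k p (2 * n) (n - 1) →
      ∀ z : ℤ × ℤ, c' ≤ (bondPercolation (slabGraph 3 k) p).real (circuitAround k z (lam * n) (2 * (lam * n))))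
    (h39 : ∀ η : ℝ, 0 < η → ∀ j : ℕ, 1 ≤ j → ∃ δ : ℝ, 0 < δ ∧ ∀ p : unitInterval,
      ε ≤ (p : ℝ) → (p : ℝ) ≤ 1 - ε → ∀ m : ℕ, m₀ ≤ m →
      1 - δ ≤ crossingProb k p (2 * m) (m - 1) → 1 - η ≤ crossingProb k p (j * m) (m - 1)) :
    ∃ c₁ : ℝ, 0 < c₁ ∧ ∀ n : ℕ, m₀ ≤ n →
      crossingProb k (criticalProbIOf (slabGraph 3 k) (slabOrigin 3 k)) (2 * n) (n - 1) ≤ 1 - c₁ := by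
  obtain ⟨c₁, hc₁, h311⟩ := lemma311_of (k := k) hε hm₀ h38 h310 h39
  refine ⟨c₁, hc₁, fun n hn => ?_⟩
  by_contra hlt
  push Not at hlt
  set q₀ : unitInterval := criticalProbIOf (slabGraph 3 k) (slabOrigin 3 k) with hq₀
  have hq₀val : (q₀ : ℝ) = criticalProb (slabGraph 3 k) (slabOrigin 3 k) := rfl
  -- continuity: the strict inequality persists on a neighbourhood of `q₀`
  set g : unitInterval → ℝ := fun p => crossingProb k p (2 * n) (n - 1) with hg
  have hcont : Continuous g := continuous_crossingProb _ _
  have hopen : IsOpen {p : unitInterval | 1 - c₁ < g p} := isOpen_lt continuous_const hcont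
  have hmem : q₀ ∈ {p : unitInterval | 1 - c₁ < g p} := hlt
  obtain ⟨r, hr, hball⟩ := Metric.isOpen_iff.1 hopen q₀ hmem
  -- a point strictly below `q₀`, still `≥ ε`, in the ball
  set δ : ℝ := min (r / 2) ((criticalProb (slabGraph 3 k) (slabOrigin 3 k) - ε) / 2) with hδ
  have hδ0 : 0 < δ := lt_min (by linarith) (by linarith)
  have hδr : δ < r := lt_of_le_of_lt (min_le_left _ _) (by linarith)
  have hδε : δ ≤ (criticalProb (slabGraph 3 k) (slabOrigin 3 k) - ε) / 2 := min_le_right _ _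
  have hq01 : (q₀ : ℝ) - δ ∈ unitInterval := by
    refine ⟨by rw [hq₀val]; linarith, ?_⟩
    have := q₀.2.2
    linarith
  set q : unitInterval := ⟨(q₀ : ℝ) - δ, hq01⟩ with hq
  have hqball : q ∈ Metric.ball q₀ r := by
    rw [Metric.mem_ball, Subtype.dist_eq, Real.dist_eq]
    show |(q₀ : ℝ) - δ - q₀| < r
    rw [show (q₀ : ℝ) - δ - q₀ = -δ by ring, abs_neg, abs_of_pos hδ0]; exact hδr
  have hgq : 1 - c₁ < g q := hball hqball
  have hqε : ε ≤ (q : ℝ) := by show ε ≤ (q₀ : ℝ) - δ; rw [hq₀val]; linarith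
  have hq1 : (q : ℝ) ≤ 1 - ε := by show (q₀ : ℝ) - δ ≤ 1 - ε; rw [hq₀val]; linarith
  -- Lemma 3.11 at `q`: `θ(q) > 0`, so `p_c ≤ q < p_c`
  have hθ := h311 q hqε hq1 n hn hgq.le
  have hle := criticalProb_le_of_theta_pos (slabGraph 3 k) (slabOrigin 3 k) q hθ
  have : (q : ℝ) < criticalProb (slabGraph 3 k) (slabOrigin 3 k) := by
    show (q₀ : ℝ) - δ < _; rw [hq₀val]; linarith
  linarith

/-! ## The upper bound (3.60) at `p_c(S_k)` -/

/-- **NTW 2017, §3.7, eq. (3.60) at `p_c(S_k)`: `sup_n f(n,2n) < 1`**, in the form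
`∃ c₂ > 0, ∀ n ≥ 1, f_{p_c(S_k)}(n, 2n) ≤ 1 - c₂` — from Lemma 3.13 (i) (via the inputs of Lemma 3.11)
and (H317): at `p_c(S_k)`, `sup_n f(n,2n) = 1 ⟹ sup_{n ≥ m₀} f(2n, n-1) = 1` (Theorem 3.17 with the
Prop. 3.9 step of §3.7).  This is the input `(H360)` of `Crossing.NewmanTassionWu2017_thm31_of`.
[cite: NewmanTassionWu2017, §3.7 eq. (3.60)] -/
theorem h360_of {ε : ℝ} (hε : 0 < ε) {m₀ : ℕ} (hm₀ : 1 ≤ m₀)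
    (hεc : ε < criticalProb (slabGraph 3 k) (slabOrigin 3 k))
    (hc1 : criticalProb (slabGraph 3 k) (slabOrigin 3 k) ≤ 1 - ε)
    (h38 : ∀ η : ℝ, 0 < η → ∃ δ : ℝ, 0 < δ ∧ ∀ p : unitInterval, ε ≤ (p : ℝ) → (p : ℝ) ≤ 1 - ε →
      ∀ m n : ℕ, m₀ ≤ m → m ≤ n → ∀ (z : ℤ × ℤ) (i : Fin 2),
      1 - δ ≤ crossingProb k p (3 * n) (2 * m) →
      1 - δ ≤ (bondPercolation (slabGraph 3 k) p).real (circuitAround k z m n) →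
      1 - δ ≤ (bondPercolation (slabGraph 3 k) p).real (circuitAround k (z + coarseShift (3 * n) i) m n) →
      1 - η ≤ (bondPercolation (slabGraph 3 k) p).real (linkEvent k z m n i))
    (h310 : ∀ c : ℝ, 0 < c → ∃ lam : ℕ, 1 ≤ lam ∧ ∃ c' : ℝ, 0 < c' ∧ ∀ p : unitInterval,
      ε ≤ (p : ℝ) → (p : ℝ) ≤ 1 - ε → ∀ n : ℕ, m₀ ≤ n → c ≤ crossingProb k p (2 * n) (n - 1) →
      ∀ z : ℤ × ℤ, c' ≤ (bondPercolation (slabGraph 3 k) p).real (circuitAround k z (lam * n) (2 * (lam * n))))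
    (h39 : ∀ η : ℝ, 0 < η → ∀ j : ℕ, 1 ≤ j → ∃ δ : ℝ, 0 < δ ∧ ∀ p : unitInterval,
      ε ≤ (p : ℝ) → (p : ℝ) ≤ 1 - ε → ∀ m : ℕ, m₀ ≤ m →
      1 - δ ≤ crossingProb k p (2 * m) (m - 1) → 1 - η ≤ crossingProb k p (j * m) (m - 1))
    (h317 : ∀ η : ℝ, 0 < η →
      (∀ δ : ℝ, 0 < δ → ∃ n : ℕ, 1 ≤ n ∧
        1 - δ ≤ crossingProb k (criticalProbIOf (slabGraph 3 k) (slabOrigin 3 k)) n (2 * n)) →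
      ∃ n : ℕ, m₀ ≤ n ∧
        1 - η ≤ crossingProb k (criticalProbIOf (slabGraph 3 k) (slabOrigin 3 k)) (2 * n) (n - 1)) :
    ∃ c₂ : ℝ, 0 < c₂ ∧ ∀ n : ℕ, 1 ≤ n →
      crossingProb k (criticalProbIOf (slabGraph 3 k) (slabOrigin 3 k)) n (2 * n) ≤ 1 - c₂ := by
  obtain ⟨c₁, hc₁, h313⟩ := lemma313_i_of (k := k) hε hm₀ hεc hc1 h38 h310 h39
  by_contra hno
  push Not at hno
  -- `sup_n f(n, 2n) = 1`
  have hsup : ∀ δ : ℝ, 0 < δ → ∃ n : ℕ, 1 ≤ n ∧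
      1 - δ ≤ crossingProb k (criticalProbIOf (slabGraph 3 k) (slabOrigin 3 k)) n (2 * n) := by
    intro δ hδ
    obtain ⟨n, hn, hlt⟩ := hno δ hδ
    exact ⟨n, hn, hlt.le⟩
  obtain ⟨n, hn, hge⟩ := h317 (c₁ / 2) (by linarith) hsup
  have := h313 n hn
  linarith

end NTW17

end Literature.Probability.Percolation

end
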